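import Summits.QuantumFields.BalabanUV.T4Continuum.Support.DirichletFreeTower

/-!
# T⁴ programme, spine node NE2 (U1a), sub-row Δ1 «NE2⁰-Dirichlet» — THE WALL'S OBJECT MADE EXPLICIT: the injected two-level defect of the
# Ω-restricted tower IS the torus COMMUTATOR DEFECT `J_k·Δ_a^{(k)} − Δ_a^{(k+1)}·J_k` (background-free, region-free) compressed to the region and
# sandwiched between the two Dirichlet Green functions

Eleventh generation of the NE2 prover lineage P1 of the cell `pub-balaban` (row NE2 owner), file 8 (addendum to files 4a/4b
`Support/DirichletRegionTower` p218991 / `Support/DirichletFreeTower` p219101).  The END `freeTowerLaws_dirichlet_of_injected` displays ONE binder,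
`hinj : ∀ k, ‖(DalevR S₀ (k+1))⁻¹·JpcTR S₀ k − JpcTR S₀ k·(DalevR S₀ k)⁻¹‖ ≤ e₁ k`.  This file proves the EXACT IDENTITY

  `(DalevR (k+1))⁻¹·JpcTR k − JpcTR k·(DalevR k)⁻¹ = G^{(k+1)}(Ω) · (J_k·Δ_a^{(k)} − Δ_a^{(k+1)}·J_k)_{Ω′Ω} · G^{(k)}(Ω)`

(`injected_eq_sandwich`): the resolvent identity `X⁻¹J − JY⁻¹ = X⁻¹(JY − XJ)Y⁻¹` plus block-multiplicativity (King's pairing never couples the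
region to its complement, `DirichletRegionTower.JpcT_vanish₁/₂`), so that `JpcTR·DalevR − DalevR′·JpcTR` is the compression of the TORUS commutator
defect `commDefect k := J_k·Δ_a^{(k)} − Δ_a^{(k+1)}·J_k` (`JpcTR_mul_DalevR_sub`).  CONSEQUENCE FOR THE CENSUS (owner record `t4/T4-EST-NE2-P1.md`
§G11.0 (C)): the Dirichlet injected law differs from the torus one (`KingPairingPlantedLaw.injected_le_lev`, which is the same identity with the
torus Green functions) ONLY through the two sandwiching resolvents; the object to estimate — for the numerics seat (Δ1-INJ) and the box supplier
(Δ1-BOX-SCALAR) alike — is `G′(Ω)·(commDefect k)_{Ω′Ω}·G(Ω)`, where `commDefect k` is a fixed local operator supported at block faces.  The crude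
bound `‖G′(Ω)‖·‖(commDefect)_{Ω′Ω}‖·‖G(Ω)‖` (`norm_injected_le_crude`) is recorded only to show the shape; it carries NO rate (‖commDefect‖ ~ η⁻²):
the rate is second-order cancellation inside the sandwich, i.e. boundary regularity — the typed wall stands.

HONEST FRAMING (T4-DAG p. 1).  [folklore] algebra over landed modules; `U = 1`, one region, finite torus, linear layer, operator norm; nothing
printed is a hypothesis; NE2 (U1a) NOT proved; spine 0/9 unchanged; NOT infinite volume, NOT a mass gap, NOT the Clay problem, NOT summit progress.
HONEST DEPENDENCY: continuum YM on T⁴ ⇐ BetaPertH ∧ nine spine estimates (0/9 proved); BetaPertH ⇐ (D1) ∧ (D4) ∧ CAP+tail; G-an2-4 gates asym,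
D1 and NE2/3/4.  No `sorry`.
-/

noncomputable section

open scoped BigOperators ComplexConjugate Matrix Matrix.Norms.L2Operator

namespace Summit.QuantumFields.BalabanUV.T4Continuum.DirichletInjectedDefect

open Literature.MathematicalPhysics.QuantumFieldTheory.Balaban1983to89.B5Prop11Plancherel (Cst Cst_nonneg Tor fine)
open Literature.MathematicalPhysics.QuantumFieldTheory.Balaban1983to89.B5G183RateUnitTower (lev lev_neZero)
open Summit.QuantumFields.BalabanUV.T4Continuum
open Summit.QuantumFields.BalabanUV.T4Continuum.BalabanAveragedTowerUnit (idx Qlev)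
open Summit.QuantumFields.BalabanUV.T4Continuum.KingPairingPlantedLaw (JpcT calDalev)
open Summit.QuantumFields.BalabanUV.T4Continuum.SubtypeCompression
open Summit.QuantumFields.BalabanUV.T4Continuum.DirichletRegionTower

variable {d : ℕ} (L : ℕ) [NeZero L] (M : Fin d → ℕ) [hM : ∀ μ, NeZero (M μ)] (a : ℝ) (ha : 0 < a)
variable (S₀ : idx L M 0 → Prop) [DecidablePred S₀]

/-- THE TORUS COMMUTATOR DEFECT of King's pairing against Bałaban's free operators at two spacings: `J_k·Δ_a^{(k)} − Δ_a^{(k+1)}·J_k`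
(background-free, region-free; supported at the block faces). [folklore] -/
def commDefect (k : ℕ) : Matrix (idx L M (k + 1)) (idx L M k) ℂ :=
  JpcT L M k * calDalev L M a ha k - calDalev L M a ha (k + 1) * JpcT L M k

section Generic

variable {m n : Type*} [Fintype m] [DecidableEq m] [Fintype n] [DecidableEq n]

/-- the resolvent identity behind every injected law: `X⁻¹J − JY⁻¹ = X⁻¹(JY − XJ)Y⁻¹` for invertible `X`, `Y`. [folklore] -/
theorem inv_mul_sub_mul_inv {X : Matrix m m ℂ} {Y : Matrix n n ℂ} (hX : IsUnit X.det) (hY : IsUnit Y.det) (J : Matrix m n ℂ) :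
    X⁻¹ * J - J * Y⁻¹ = X⁻¹ * (J * Y - X * J) * Y⁻¹ := by
  symm
  rw [Matrix.mul_sub, Matrix.sub_mul]
  have h1 : X⁻¹ * (J * Y) * Y⁻¹ = X⁻¹ * J := by
    rw [Matrix.mul_assoc, Matrix.mul_assoc, Matrix.mul_nonsing_inv Y hY, Matrix.mul_one]
  have h2 : X⁻¹ * (X * J) * Y⁻¹ = J * Y⁻¹ := by
    rw [← Matrix.mul_assoc, Matrix.nonsing_inv_mul X hX, Matrix.one_mul]
  rw [h1, h2]

end Generic

/-- **COMPRESSION TURNS THE REGION'S DEFECT INTO THE TORUS COMMUTATOR DEFECT**: `JpcTR k·DalevR k − DalevR (k+1)·JpcTR k = (commDefect k)_{Ω′Ω}`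
(King's pairing never couples the region to its complement). [folklore] -/
theorem JpcTR_mul_DalevR_sub (k : ℕ) :
    JpcTR L M S₀ k * DalevR L M a ha S₀ k - DalevR L M a ha S₀ (k + 1) * JpcTR L M S₀ k
      = (commDefect L M a ha k).toBlock (inReg L M S₀ (k + 1)) (inReg L M S₀ k) := by
  rw [commDefect, toBlock_sub, JpcTR, DalevR, DalevR,
    toBlock_mul_of_vanish_left _ (inReg L M S₀ k) _ _ _ (JpcT_vanish₁ L M S₀ k),
    toBlock_mul_of_vanish_right _ (inReg L M S₀ (k + 1)) _ _ _ (JpcT_vanish₂ L M S₀ k)]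

/-- **THE WALL'S OBJECT**: `(DalevR (k+1))⁻¹·JpcTR k − JpcTR k·(DalevR k)⁻¹ = G^{(k+1)}(Ω)·(commDefect k)_{Ω′Ω}·G^{(k)}(Ω)` — the injected two-level defect of
the Dirichlet tower is the torus commutator defect compressed and sandwiched between the two Dirichlet Green functions. [folklore] -/
theorem injected_eq_sandwich (k : ℕ) :
    (DalevR L M a ha S₀ (k + 1))⁻¹ * JpcTR L M S₀ k - JpcTR L M S₀ k * (DalevR L M a ha S₀ k)⁻¹
      = (DalevR L M a ha S₀ (k + 1))⁻¹ * (commDefect L M a ha k).toBlock (inReg L M S₀ (k + 1)) (inReg L M S₀ k)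
          * (DalevR L M a ha S₀ k)⁻¹ := by
  rw [inv_mul_sub_mul_inv (isUnit_det_DalevR L M a ha S₀ (k + 1)) (isUnit_det_DalevR L M a ha S₀ k), JpcTR_mul_DalevR_sub]

/-- the CRUDE consequence (shape only, NO rate): `‖(DalevR (k+1))⁻¹·JpcTR k − JpcTR k·(DalevR k)⁻¹‖ ≤ ((d+1)Cst)²·‖(commDefect k)_{Ω′Ω}‖` — the two
resolvents are bounded uniformly (`opNorm_inv_DalevR_le`); the rate of `hinj` must come from cancellation INSIDE the sandwich (boundary regularity),
since `‖commDefect k‖` itself is of the order of the lattice Laplacian. [folklore] -/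
theorem norm_injected_le_crude (k : ℕ) :
    ‖(DalevR L M a ha S₀ (k + 1))⁻¹ * JpcTR L M S₀ k - JpcTR L M S₀ k * (DalevR L M a ha S₀ k)⁻¹‖
      ≤ (((d : ℝ) + 1) * Cst d a) ^ 2 * ‖(commDefect L M a ha k).toBlock (inReg L M S₀ (k + 1)) (inReg L M S₀ k)‖ := by
  rw [injected_eq_sandwich]
  have h1 := opNorm_inv_DalevR_le L M a ha S₀ (k + 1)
  have h0 := opNorm_inv_DalevR_le L M a ha S₀ k
  have hK : 0 ≤ ((d : ℝ) + 1) * Cst d a := (K_pos (d := d) a).le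
  calc _ ≤ ‖(DalevR L M a ha S₀ (k + 1))⁻¹ * (commDefect L M a ha k).toBlock (inReg L M S₀ (k + 1)) (inReg L M S₀ k)‖
          * ‖(DalevR L M a ha S₀ k)⁻¹‖ := Matrix.l2_opNorm_mul _ _
    _ ≤ ‖(DalevR L M a ha S₀ (k + 1))⁻¹‖ * ‖(commDefect L M a ha k).toBlock (inReg L M S₀ (k + 1)) (inReg L M S₀ k)‖
          * ‖(DalevR L M a ha S₀ k)⁻¹‖ := mul_le_mul_of_nonneg_right (Matrix.l2_opNorm_mul _ _) (norm_nonneg _)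
    _ ≤ (((d : ℝ) + 1) * Cst d a) * ‖(commDefect L M a ha k).toBlock (inReg L M S₀ (k + 1)) (inReg L M S₀ k)‖
          * (((d : ℝ) + 1) * Cst d a) :=
        mul_le_mul (mul_le_mul_of_nonneg_right h1 (norm_nonneg _)) h0 (norm_nonneg _) (mul_nonneg hK (norm_nonneg _))
    _ = _ := by ring

/-- the same identity ON THE TORUS (no region): `𝒢^{(k+1)}J_k − J_k𝒢^{(k)} = 𝒢^{(k+1)}·(commDefect k)·𝒢^{(k)}` — the torus injected law
`KingPairingPlantedLaw.injected_le_lev` is a bound on this very sandwich, with the torus Green functions in place of the Dirichlet ones. [folklore] -/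
theorem injected_eq_sandwich_torus (k : ℕ) :
    (calDalev L M a ha (k + 1))⁻¹ * JpcT L M k - JpcT L M k * (calDalev L M a ha k)⁻¹
      = (calDalev L M a ha (k + 1))⁻¹ * commDefect L M a ha k * (calDalev L M a ha k)⁻¹ :=
  inv_mul_sub_mul_inv (KingPairingPlantedLaw.isUnit_det_calDalev L M a ha (k + 1))
    (KingPairingPlantedLaw.isUnit_det_calDalev L M a ha k) _

end Summit.QuantumFields.BalabanUV.T4Continuum.DirichletInjectedDefect

end
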